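import Mathlib
import HarnessLib
import HarnessLib.Audit
import Summits.MatrixMultiplication.Statement
import Literature.Computability.AlgebraicComplexity.SchoenhageTau
import Literature.Computability.AlgebraicComplexity.AsymptoticSpectrum
import Literature.Computability.AlgebraicComplexity.TripartitionTensor
import HarnessLib.Audit.Status.Attr
-- import Summits.MatrixMultiplication.MatrixMultiplication.Theorems.FidelityWitnessesFidelityGapTwoSix dropped: it (transitively) imports this route file — proofs used by `closes`/`_holds` must live in a module that does not import the Theses file

/-!
Route: FidelityWitnesses

DORMANT since 2026-08-23T19:54:21Z (reconciler: no traction for 6.2 d (last activity item-evidence-added at 2026-08-17T14:27:53Z); parked, not closed — `ledger route dormant route-MatrixMultiplication-FidelityWitnesses --off` to reactiv) — unstaffed, not closed; items shared with open routes are served there. `ledger route dormant <id> --off` reactivates.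

# Route FidelityWitnesses — Fidelity witnesses — border-rank lower bounds for ⟨n,n,n⟩ as certified
overlap gaps λ_r < 1 (positivity, not equations)

REFUTATION line (targets ¬MatrixMultiplication, i.e. ω(ℂ) > 2), realising idea card
fidelity-witnesses-border-rank.
OBJECTS. T = ⟨n,n,n⟩ (‖T‖² = n³; as an element of M_n ⊗ M_n ⊗ M_n it is the CYCLIC SHIFT on
(ℂⁿ)^{⊗3}, so for a sum of r
triads S = Σ_l u_l⊗v_l⊗w_l one has ⟨S,T⟩ = Σ_l tr(u_l v_l w_l) and ‖S‖² = Σ_{l,m} tr(u_l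
u_m*)·tr(v_l v_m*)·tr(w_l w_m*)).
FIDELITY |⟨S,T⟩|²/(‖S‖²‖T‖²); M(n,r) := sup{|⟨S,T⟩|²/‖S‖² : R(S) ≤ r} — a sup over HONEST rank-≤ r
tensors, hence a max
over their closure, and n³ − M(n,r) = dist(T, σ̂_r)² (σ̂_r the closed cone of border rank ≤ r).
COMPLETENESS: M(n,r) < n³
⟺ T ∉ σ̂_r ⟺ bR(T) > r (cone closure + Alder–Strassen; kernel-checked in the direction used:
`fidelityGapTwoSix_proof`,
and at n = 3 `eighteen_le_algBorderRank_of_fidelityGapThreeSeventeen` /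
`algBorderRank_le_seventeen_of_not_fidelityGapThreeSeventeen`,
Theorems/FidelityGapThreeSeventeen/Negative/BorderRankReduction.lean, p73201).
The third factor ELIMINATES EXACTLY (least squares): M(n,r) = max over (u_l,v_l)_{l≤r} of ‖(P_E ⊗
1)T‖², E = span{u_l⊗v_l}
⊂ ℂ^{n²}⊗ℂ^{n²} — a compact secant-Grassmannian height problem (crux ideators,
Cruxes/SevenEighthsLaw/Ideas/slice-elimination-*).

X = FidelityThesis: "it suffices to show" a UNIFORM FIDELITY GAP ALONG A SUPERQUADRATIC CURVE — δ, c
> 0 such that for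
all n ≥ 1 and all r ≤ c·n^{2+δ} some ε > 0 has |⟨S,⟨n,n,n⟩⟩|² ≤ (1−ε)·n³·‖S‖² for every S of rank ≤
r. X ⟺ [∀n,
bR(⟨n,n,n⟩) > c·n^{2+δ}] ⟺ ω > 2 (Bini `Blaser2013_thm66_holds` + completeness): X is exactly as
true as ¬Statement.
Lean: `∃ δ : ℝ, 0 < δ ∧ ∃ c : ℝ, 0 < c ∧ ∀ n r : ℕ, 1 ≤ n → (r : ℝ) ≤ c * (n : ℝ) ^ (2 + δ) → ∃ ε :
ℝ, 0 < ε ∧ ∀ S : Fin n × Fin n → Fin n × Fin n → Fin n × Fin n → ℂ,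
Literature.Computability.AlgebraicComplexity.tensorRank S ≤ r → ‖∑ a, ∑ b, ∑ c, S a b c *
Literature.Computability.AlgebraicComplexity.matMulTensor ℂ n n n a b c‖ ^ 2 ≤ (1 - ε) * (n : ℝ) ^ 3
* ∑ a, ∑ b, ∑ c, ‖S a b c‖ ^ 2`

WHY THIS FORM IS EASIER (the target is summit-equivalent; this is the stated reason, D-0031 §2 axis
1). (a) It trades
EQUATIONS of σ_r (unknown beyond degree ≈ n²; every linear / apolarity method is cactus-capped at
6n² − 4,
LinearRankMethodBarrier) for ONE INEQUALITY valid on σ_r and violated at T, and the symmetry K =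
U(n)³ × ℤ₃ of T collapses
"all witnesses" to a COMPLETE 4-parameter normal form: bR(⟨n,n,n⟩) > r ⟺ the closed convex cone
K_r(n) ⊂ ℝ⁴ of isotypic
weights a with Q_a(S) = Σ_j a_j‖Π_j S‖² ≥ 0 on sums of r triads meets {a_0 < 0} (§ Rationale (2)) —
hidden structure exposed:
the unknown object is a point of ℝ⁴, for every n. (b) The transferred problem is an r-POSITIVITY /
polynomial-optimisation
problem with symmetry, a problem TYPE with a record of closing SHARP extremal statements that
equations never touched:
Cohn–Elkies LP bounds → Viazovska2017 (E₈), flag-algebra SDP certificates (Razborov2007; exact Turán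
densities),
the NPA hierarchy (NavascuesPironioAcin2008; Tsirelson-type bounds, dimension-free),
Bachoc–Vallentin SDP bounds
(BachocVallentin2007); on THIS problem the dictionary is kernel-checked at (2,6) and (3,17) and a
checked explicit-ε skeleton
exists (Cruxes/FidelityGapTwoSix/Lines/quantitative-apolarity.lean). (c) The n-UNIFORMITY that X
demands has a precise home:
every K × S_r-invariant certificate identity is a linear combination of trace DIAGRAMS whose only
n-dependence is the loop value
tr 1 = n and whose S_r-dependence stabilises (first fundamental theorem; representation stability,
ChurchEllenbergFarb2015;
Eggeling–Werner's "dimension as a parameter" computation is the degree-1 instance,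
EggelingWerner2001; dimension-free SOS:
Helton2002 = BlekhermanParriloThomas2012 Thm 8.10, KlepMagronVolcic2021), so "a bounded-degree
certificate uniform in (n, r)" is
ONE finite SDP feasibility problem per degree with entries in ℚ[N, R] — the uniform template is an
object, not a hope, and its
non-existence at every degree is Kill (iii). (d) TWO REGIMES, two levers. UNIT SCALE (r near bR):
Frobenius error buys border
rank no cheaper than deleting products — SevenEighthsLaw (M(2,6) = 7, sharp, lead instance),
SixEighthsAtFive, LinearDefectLaw
(dist² ≥ bR − r). POWER SCALE (r = n², strictly inside known territory bR ≥ 2n² − n,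
LandsbergOttaviani2015): DiagonalPowerDecay —
n² (border) multiplications capture at most C·n^{3−2δ} of the n³ units — which ALONE implies
¬Statement by block self-similarity
(p copies of ⟨m,m,m⟩ inside ⟨pm,pm,pm⟩ give M(pm, p·R(⟨m⟩)) ≥ p·m³; with p = ⌈R(⟨m⟩)/m²⌉ the decay
forces log_m R(⟨m,m,m⟩) ≥
2 + δ/(1−δ) − o(1), i.e. ω ≥ 2 + δ/(1−δ)), is by its defining inequality OUTSIDE every linear rank
method (they certify at
best a constant captured fraction n²/bR_L ≥ 1/6 at r = n²), and predicts a measurable decay rate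
φ(n) := M(n,n²)/n³ ≈
n^{−(2 − 2/(ω_eff − 1))} (Strassen-effective sizes: n^{−0.89}; observed lower estimates 0.552, ≥
0.370, ≥ 0.304 at n = 2, 3, 4
against 0.540, 0.376, 0.292).

## Assembly
Pure logic plus proved theorems of the tree. (i) Certified deciding theorem `closes : FidelityThesis
→ ¬MatrixMultiplication`
(rev 1, axioms propext/Classical.choice/Quot.sound): given (δ, c), fix n ≥ 1 and r := R(⟨n,n,n⟩); if
r ≤ c·n^{2+δ} the gap at
(n, r) applied to S := ⟨n,n,n⟩ itself reads n⁶ ≤ (1−ε)·n⁶, absurd; hence c·n^{2+δ} < R(⟨n,n,n⟩) for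
all n, every admissible
exponent is ≥ 2 + δ, ω(ℂ) = sInf ≥ 2 + δ > 2. (ii) Second, independent glue (to be filed as a
provable-now support when a slot
frees; tree lemmas `matMulDirectSum`, `omega_le_logb_tensorRank_matMulTensor`,
`Blaser2013_thm66_holds`): DiagonalPowerDecay →
¬MatrixMultiplication by the block argument above, and DiagonalPowerDecay → FidelityThesis via
bR(⟨n,n,n⟩) ≥ n^ω (Bini).
State of the ladder (2026-08-16): rung (2,6) FidelityGapTwoSix PROVED by closure-transfer (no
positivity content; ε ≤ 1/8 forced,
Cruxes/FidelityGapTwoSix/Disproof.lean); open cruxes LinearDefectLaw (rank 2),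
FidelityGapThreeSeventeen (rank 3, ⟺ 18 ≤
bR(⟨3,3,3⟩), kernel-certified), SevenEighthsLaw (rank 4, lead instance, M(2,6) = 7),
DiagonalPowerDecay (rank 5, the uniform
layer); supports calibrate the technology (SixEighthsAtFive, FidelityGapTwoSixExplicit,
FlatteningWitness, RankTwoAdditivity,
RankThreeDefect, FidelityGapThreeSixteen) and record soundness/completeness (GapImpliesBorderRank,
WitnessCompleteness).

Rationale: WHY THIS LINE. Mechanism (card fidelity-witnesses-border-rank), sharpened at promotion gen 1–2
(2026-08-16). (1) COMPLETENESS: for the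
closed ℂ*-stable cone σ̂_r, T ∉ σ̂_r iff the fidelity form (1−ε)‖T‖²·I − TT* is non-negative on σ̂_r
for some ε > 0 (sphere
compactness; Regula2017 generic witness/robustness duality; DohertyParriloSpedalieri2004 for r = 1);
kernel-checked in the
direction used at (2,6) (`fidelityGapTwoSix_proof` = `notMem_closure_six` ∘ `stub_coneClosure`) and
at (3,r) for all r
(`fidelityGapThree_iff_lt_algBorderRank` in Cruxes/FidelityGapThreeSeventeen/Disproof.lean; landed
one-directional forms
`eighteen_le_algBorderRank_of_fidelityGapThreeSeventeen` /
`algBorderRank_le_seventeen_of_not_fidelityGapThreeSeventeen`, p73201;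
Alder–Strassen is the tree theorem `alder_secantVariety_eq_setOf_algBorderRank_le_holds`).
(2) THE OBJECT — the ISOTYPIC WITNESS CONE. Averaging a witness over the compact stabiliser K =
U(n)³ (σ_r is K-stable, T is the
UNIQUE K-fixed tensor up to scale) and over ℤ₃ lands it in the commutant of K on (ℂ^{n×n})^{⊗3} ≅ (ℂ
⊕ sl_n)^{⊗3} (8 sectors,
multiplicity-free, 4 ℤ₃-orbits), so EVERY witness is Q_a(S) = Σ_{j=0}^{3} a_j‖Π_j S‖², a ∈ ℝ⁴ (Π_j =
projector onto the sectors
with j traceless legs, Π_0 S = ⟨S,T⟩T/n³), and bR(⟨n,n,n⟩) > r ⟺ K_r(n) := {a : Q_a ≥ 0 on sums of r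
triads} meets {a_0 < 0};
K_r(n) ⊂ ℝ⁴ is a nested family of closed convex cones, K_∞ = the orthant, the fidelity curve is its
section a_1 = a_2 = a_3, the
flattening witness is the point nr·(1,1,1,1) − n³e_0. For a triad t = u⊗v⊗w the sector weights are
explicit trace monomials
(m_∅ = ‖u‖²‖v‖²‖w‖², m_1 = ‖wu‖²‖v‖²/n, …, m_123 = |tr(uvw)|²/n³; inclusion–exclusion over legs) and
the kernel k_a(t,t′) is their
polarisation (traces of words of length ≤ 6), so "bR(⟨n,n,n⟩) > r" is literally an r-POSITIVITY
statement for ONE explicit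
invariant Hermitian trace polynomial in 3r matrix variables whose coefficients do not depend on n.
(3) CERTIFICATES and what
they evade: a trace-SOS / diagrammatic certificate (GatermannParrilo2004 symmetry reduction;
KlepMagronVolcic2021; Helton2002)
quantifies over HONEST r-tuples only, so cactus points never enter — unlike every linear rank method
and weak border apolarity
(LinearRankMethodBarrier, BuczynskaBuczynski2026 Thm 1–2). Representation stability makes the
certificate FORMAL in (n, r):
invariants are trace diagrams with loop value n (first fundamental theorem) and S_r-types stabilise
for r ≥ 2·degree
(ChurchEllenbergFarb2015), so a bounded-degree certificate uniform in (n,r) is a finite SDP with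
entries in ℚ[N,R], PSD on a
semialgebraic region — univariate/bivariate matrix Positivstellensätze apply. (4) WHAT THE FIRST
RUNG TAUGHT (stmt-4957 evidence,
PICKED.md): every purely existential fixed-(n,r) witness statement is transfer-closable from a
border-rank fact (zero positivity
content), so only EXPLICIT-CONSTANT statements exercise the technology; ε ≤ 1/8 is forced at (2,6)
and attained by the honest
rank-6 Winograd point ⟨2,2,2⟩ − e; a reported NO-GO (Evidence-4957.md, unverified): no Reznick/DPS
multiple of the
factor-coordinate gap form is SOS for r ≥ 3 — naive Lasserre levels are dead if it holds; the
compact reparametrisations survive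
(annihilator Grassmannian: line quantitative-apolarity, ε = φ₀²/640; secant Grassmannian: slice
elimination, below). (5) THE
UNIT-SCALE BET — LinearDefectLaw: ⟨n,n,n⟩ is nuclear-flat (spectral norm 1, nuclear norm n³ = ‖T‖²,
Derksen2015), and for an
orthogonal projection P Eckart–Young–Mirsky gives rank B ≥ rank P − ‖P − B‖²_F (Mirsky1960; for
tensors only the critical-space
half of Eckart–Young survives, DraismaOttavianiTocino2018 Thm 1.1, generic f); the conjectured
border-rank analogue dist(⟨n,n,n⟩,
σ̂_r)² ≥ bR − r holds on the charted n = 2 curve, TIGHT at r = 5 (Bini) and 6 (Winograd point), and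
turns fidelity NUMERICS into
border-rank UPPER bounds (bR ≤ n³ + r − M(n,r): M(3,17) > 24 would force bR(⟨3,3,3⟩) ≤ 19). (6) THE
POWER-SCALE BET —
DiagonalPowerDecay (gen 2): at r = n² the captured fraction φ(n) = M(n,n²)/n³ decays like a power;
it implies ¬Statement by block
self-similarity alone (§ Thesis (d)), is outside every linear method by its defining inequality, and
is what an (n,r)-formal
certificate of bounded degree would deliver (semialgebraic margins are powers of n). Imported areas,
each with the explicit
dictionary above: convex duality / entanglement witnesses with symmetry (EggelingWerner2001;
BengtssonZyczkowski2017 §16), free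
real algebraic geometry (Helton2002, HeltonMccullough2004, KlepMagronVolcic2021), metric algebraic
geometry (DraismaEtAl2015,
DraismaOttavianiTocino2018, DesilvaLim2008), certified numerical AG
(HauensteinIkenmeyerLandsberg2013), additive combinatorics of
subspaces / Loomis–Whitney (LoomisWhitney1949, BachocSerraZemor2018Kneser, EllisEtAl2016; § NOT
DECOMPOSED YET). What it does
that BorderRankLowerBound, ApproximationProfile and card brent-refutation-depth do not: inequalities
on σ_r with a complete
4-parameter normal form, exact values of the distance profile (7 = M(2,6), 6 = M(2,5), 3 + √2 =?
M(2,4)), a unit-scale rigidity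
law, and a power-scale crux that refutes ω = 2 on its own.

RANKED CRUXES. #0 FidelityThesis (target) — X; ⟺ ω > 2; implied by #5; decided negatively by any ω =
2 proof. #2 LinearDefectLaw
(crux, stmt-14039) — ∀ n r S, rank S ≤ r → |⟨S,⟨n,n,n⟩⟩|² ≤ (n³ + r − bR(⟨n,n,n⟩))·‖S‖². Technique:
at n = 2 (bR = 7, tree) it is the
ladder M(2,k) ≤ k + 1, attacked by the UNIT EXCESS potential Φ(E) = 2·tr(P_E Π_F) − dim E ≤ 1 on
product-spanned subspaces E ⊂
M₂⊗M₂ with an exchange inequality at positive running excess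
(Cruxes/SevenEighthsLaw/Ideas/unit-excess-law.md; numerics k = 3,4,5:
1.503, 2.2070 ≈ (3+√2)/2, 2.9992↗3, never above); bite: after exact elimination of the output factor
the law is a height bound on a
compact secant Grassmannian, no cancellation ratio; first lemma: SliceElimination M(2,k) = 2·max_E
tr(P_E Π_F) (provable now,
Bessel) and RankFiveLaw M(2,5) ≤ 6 (= support SixEighthsAtFive). General n: k = 1 rung UnitDefect (r
< bR ⇒ dist ≥ 1) then induction
in the defect (robust Eckart–Young step). #3 FidelityGapThreeSeventeen (crux, stmt-4958) — ⟺ 18 ≤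
bR(⟨3,3,3⟩) (KERNEL-CERTIFIED,
Negative/BorderRankReduction.lean, p73201): a declared FRONTIER INSTANCE = the open problem itself
(window [17,20], Smirnov2013 /
ConnerHarperLandsberg2023), not load-bearing for X, staffed because either outcome is a theorem.
Technique (proof side): border
apolarity at r = 17 sharpened by tests CHL never ran — symbolic-square ideals J = lim I(2Γ_ε) with
I·I ⊆ J (computed: degree-3 BA
has ≥ 499 surviving Borel-fixed candidates at r = 17, the new test kills all sampled but one
structural family; Ideas/
symbolic-square-border-apolarity.md), nested apolarity flags, punctual/sticky saturation
(JelisiejewMandziuk2025 fibre obstruction),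
domino substitution (tree-proved border-substitution steps first); (refutation side): border-ALS for
order-h ε-schemes at r =
17…21 (kit j008988, j009412), warned by TichavskyPhanCichocki2017 (their LM study missed Smirnov's
20). First lemma: the one
surviving symbolic-square family, decided exactly mod p. Tightness landed: ε ≤ 7/27, M(3,17) ≥ 20
(S20, Negative/Tightness.lean).
#4 SevenEighthsLaw (crux, stmt-4959; LEAD INSTANCE) — M(2,6) = 7. NEW, SHARP (Winograd point and its
K-orbit; Bini-plus-one family
7 − 28/(7m²+4) ↑ 7, Disproof.lean `tight`, so no strengthening 7 − η holds), evidence 160/160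
restarts → 3.5000000 = M/2 with rigid
profile (1,1,1,½) after exact output elimination (kit j008098), 80-restart CP-ALS 7.000000 (review),
disprover's pencil T_u = T +
(u−1)E: any root u₀ ∉ {0} of [T_u ∈ σ₆] with |log u₀| < 2√2 kills it (u-scan j008075). Technique /
bite / first lemma, three
passing shapes on file: (i) LOCAL RIGIDITY + GLOBAL SLACK — exact rational constrained Hessian
(curvature term ⟨∇f, II⟩ included)
at the smooth point ⟨2,2,2⟩ − e of the 60-fold σ̂₆, kit j008849 decides it; then every remaining
inequality is strict; (ii)
STABILISER CAPACITY — ⟨S,T⟩ is a G_T ≅ GL₂³-invariant linear form, fidelity = |ℓ|²/capacity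
(Kempf–Ness), Hilbert–Mumford
reduction to the support, first lemma ParametricSeven: bR(T_χ) = 7 for all χ ≠ 0 (finite exact
computation, kit j008313); (iii)
SHARP GRASSMANN APOLARITY — composition BorderLeRank → QuantWeakApolarity6 → ProjectionBound →
SharpGrassmannApolarity →
SevenEighthsLaw PROVED in the ideator's Sketch (min height ½ of passing 10-planes on Gr(10, A*⊗B*)).
#5 DiagonalPowerDecay (crux,
NEW gen 2, rank 5 = the uniform layer) — ∃ C, δ > 0 ∀ n ∀ S, rank S ≤ n² → |⟨S,⟨n,n,n⟩⟩|² ≤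
C·n^{3−2δ}·‖S‖². STRONGER than
¬Statement (it adds robustness: no rank-n^{2+o(1)} family reaches captured fraction n^{−o(1)}) and
implies it by block
self-similarity; why this form: one point of the profile per n, inside known territory (bR ≥ 2n² −
n), power gap ⇒ outside the
linear-rank class by definition, conjectured extremisers = block-diagonal fast algorithms (φ(n) ≈
n^{−(2−2/(ω_eff−1))}).
Technique: (n,r)-formal diagrammatic certificates improving the flattening witness M ≤ nr by a power
of n in the window n ≤ r ≤ n²;
bite: K_{n²}(n) is 4-dimensional for every n, and r = n² is just past the reach of plain flattening
equations (r ≤ n² − 1) and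
well inside Koszul's (2n² − n), so T ∉ σ_r is classical there with margin n² − n; first
lemma: the two smallest diagonal values EXACTLY — M(2,4) (= 3 + √2 ?, i.e. K_4(2)) and M(3,9) — and
the provable-now glue
DiagonalPowerDecay → ¬Statement. Honest status: no tool gives power gaps today ("no tool" on the
asymptotic layer is the route's
standing risk, priced in Kill (iii)/(vi)). #9 supports: FlatteningWitness (=
ApproximationProfile.LowerFrame; inside the linear
class), GapImpliesBorderRank, WitnessCompleteness (⇒ direction landed as `stub_coneClosure`),
FidelityGapThreeSixteen (⟺ CHL Thm
1.1, `sixteen_iff_CHL`; transfer-closable calibration rung — the slot to free for the #5 glue),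
RankTwoAdditivity (M(n,2) = 2 ∀ n:
the smallest DIMENSION-FREE trace inequality of the programme), RankThreeDefect (3.0058 > 3,
provable-now), SixEighthsAtFive
(M(2,5) ≤ 6, Bini-tight), FidelityGapTwoSixExplicit (ε = 10⁻⁵; home of line quantitative-apolarity).
CLOSED: FidelityGapTwoSix
(PROVED 2026-08-16, closure-transfer).

TWO-LAYER PLAN. Foreseen glued splits (none filed; k ≤ 3). SevenEighthsLaw ⇐ LocalRigidity (strict
local max at the Winograd
point modulo K, exact rational Hessian) → CoarseGap (M(2,6) ≤ 7.5 by any certificate;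
KoszulWitnessTwoFive gives 7.5 at r = 5
already, ideator-3 NOTES) → CriticalOrbitCensus (no other critical K-orbit of σ̂₆ with value in (7,
7.5]); or ⇐ SliceElimination
→ ExchangeStepSix. LinearDefectLaw ⇐ UnitDefect → InductionInDefect. FidelityThesis ⇐
DiagonalPowerDecay (+ the provable-now
glue via `omega_le_logb_tensorRank_matMulTensor` / `Blaser2013_thm66_holds` / `matMulDirectSum`).
DiagonalPowerDecay ⇐
SubspaceLoomisWhitney-stability (near-extremal boxes are near blocks) → DiagonalCertificate (an
(n,r)-formal certificate of M(n,r)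
≤ C·r·n^{1−2δ} on n ≤ r ≤ n²) — only after the K_r(2), K_r(3) charts and the box numerics (kit
j010045) say which diagrams.

KILL CRITERIA. (i) SevenEighthsLaw refuted (a rank-6 S with |⟨S,T⟩|² > 7‖S‖², Gaussian-rational,
`norm_num`; or the Hessian test
j008849 indefinite; or a pencil root u₀): records M(2,6) > 7, kills LinearDefectLaw at once; neither
is load-bearing for X —
drop both, the line keeps #3, #5 and the explicit-ε programme. (ii) LinearDefectLaw refuted at n =
3, 4 by kit numerics made exact:
drop it, record the defect data on ApproximationProfile. (iii) A verified NO-GO that every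
K×S_r-invariant certificate of bounded
degree for Q_a ≥ 0 on σ_r factors through flattening spectra, or certifies only r ≤ C·n², or that NO
(n,r)-formal certificate of
any fixed degree exists on the diagonal: the technology re-enters LinearRankMethodBarrier's reach —
close `exhausted` with the
census and hand the positivity barrier to the catalogue. (iv) FidelityGapThreeSeventeen refuted
(bR(⟨3,3,3⟩) = 17): a theorem in
itself; pivot rung 3 to (4, r). (v) Any positive route proving ω = 2 refutes FidelityThesis and
DiagonalPowerDecay via `closes`:
close `refuted:FidelityThesis`. (vi) DiagonalPowerDecay refuted by a rank-≤ n² family with captured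
fraction n^{−o(1)} (e.g. an
L²-approximate bilinear scheme of rank n^{2+o(1)} with vanishing-power error; Pagh2013-type
compressed products give only ≤ 1/2
unit per multiplication and do not): drop #5, X loses its only filed antecedent, route reverts to a
certification programme
(honest B). A plateau of φ(n) for n ≤ 6 is a warning, not a kill.

NOT DECOMPOSED YET. The chart of K_r(2) (r = 3…6) and K_r(3) (r ≤ 16). The SUBSPACE LOOMIS–WHITNEY
conjecture E(U,V,W) :=
‖(P_U⊗P_V⊗P_W)⟨n,n,n⟩‖² ≤ (dim U·dim V·dim W)^{1/2} for subspaces of M_n (coordinate subspaces =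
triangle counting, LoomisWhitney1949,
a theorem; equality at rectangular blocks M_{a×b}⊗M_{b×c}⊗M_{c×a}; it is the best
multilinear-rank-(r,r,r) approximation value,
so HOOI tests it — kit j010045) and its STABILITY (EllisEtAl2016 analogue): together they give the
dimension-free bound M(n,r) ≤
r^{3/2} (the free replacement of flattening, sharper iff r < n²) and reduce the free decay exponent
γ := lim log sup_n M(n,r)/log r
(γ ≥ 3/ω by block algorithms, γ ≤ 3/2 if the conjecture holds) to the diagonal. The verification of
the Reznick/DPS no-go ((r,N)
= (3,1), one exact SDP). The first (n,r)-FORMAL certificate: re-derive FlatteningWitness and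
KoszulWitnessTwoFive (M(2,5) ≤ 7.5)
as diagrammatic identities over ℚ[N] (calibration of the stable SDP). An `IsSOS`/certificate
predicate (no Lean statement about
certificates until agreed). Exact values M(2,3) (3.00581…) and M(2,4) (2·2.2070 = 4.4140 ≈ 3 + √2).
The #5 glue as a support
item (slot: FidelityGapThreeSixteen). Re-landing `fidelityGapTwoSix_proof` in a non-importing module
(`FidelityGapTwoSix_holds`
materialisation; prover/operator).

CHEAPEST FALSIFIER. For the LEAD and the unit-scale LAW together: the exact rational second-order
test at the Winograd point (kit
j008849: Terracini rank 60, constrained Hessian with curvature term — an indefinite form gives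
M(2,6) > 7 along the ascent
direction) and the pencil u-scan (j008075); then border-ALS values M(3,r), r = 12…17 against r + 27
− bR. For the power-scale
crux: the diagonal profile φ(n) = M(n,n²)/n³, n = 2…5 (kit j010048; predicted ≈ n^{−0.89} at
Strassen-effective sizes: 0.540,
0.376, 0.292, 0.239; a plateau is the warning sign) and the box test (j010045: any E > r^{3/2} kills
SubspaceLoomisWhitney, not
the crux). For the certificate technology: the level-1 balanced SDP at (2,6) and the degree-2
(n,r)-formal SDP for the
flattening identity. What has been run (seven seats, 2026-08-15/16): M(2,1..7) = 1, 2, 3.005813,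
4.4140, 5.997→6, 7.0000000
(160/160, 80/80, 40/40; never above), 8; M(3,2..9) ≥ 2, 3.00581, 4, 5, 6.96, 7.99, 8.97, 9.998
(under-converged); M(3,17) ≥ 20
(kernel-checked); honest-ascent plateau 6.794 at (2,6); frame-gap landscape min 0.2697 on St(2,ℂ¹²).

NUMBERS. Fidelity data (lower estimates unless exact): M(2,r), r = 0..7: 0, 1, 2, 3.005813, 4.4140
(3 + √2 = 4.41421?), 6 (Bini,
border), 7 (Winograd point, honest; ≥ PROVED, ≤ = SevenEighthsLaw), 8 (Strassen). Defects 8 − M(2,r)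
≥ bR − r = 7, 6, 5, 4, 3,
2, 1, 0 with equality at r = 5, 6, 7. Diagonal φ(n) = M(n,n²)/n³: 0.5518 (n = 2), ≥ 0.3703 (n = 3),
≥ 0.3044 (n = 4, from M(2,4)²);
block-algorithm heuristic φ(n) ≈ n^{−(2−2/(ω_eff−1))}: ω_eff = log₂7 → n^{−0.893} = 0.540, 0.376,
0.292; ω_eff = 2.37 → n^{−0.54}.
Block self-similarity: M(pm, p·R(⟨m⟩)) ≥ p·m³; M(2^k, 7^k) = 8^k; free exponent γ ∈ [3/ω, 3/2?] ⊂
[1.26, 1.5]. Flattening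
M(n,r) ≤ n·r; box M(n,r) ≤ E ≤ r² (two Cauchy–Schwarz), conjecturally ≤ r^{3/2}; trivial M ≥ r,
M(n+1,r) ≥ M(n,r), super-additive
over blocks, super-multiplicative under Kronecker. Border-rank facts (tree / vendored): bR(⟨2,2,2⟩)
= 7 (PROVED), bR(⟨3,3,3⟩) ∈
[17, 20] (16 ≤ · PROVED in tree, LandsbergMichalek2018; 17: ConnerHarperLandsberg2023 named fact; ≤
20 Smirnov2013 kernel-checked),
≥ 2n² − n (LandsbergOttaviani2015); caps 6n² − 4 (Buczynski2026), 8n²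
(EfremenkoGargOliveiraWigderson2018 Thm 4.4). Isotypic data:
8 sectors of (ℂ ⊕ sl_n)^{⊗3}, dims 1, 3×(n²−1), 3×(n²−1)², (n²−1)³. Items after this edit: 15
(target, assembly, 5 cruxes of which
1 closed, 8 supports).

DEFINITION REQUESTS. None (fidelity inlined; `tensorRank`, `matMulTensor`, `algBorderRank`, `omega`
in
Literature.Computability.AlgebraicComplexity). Optional later: `fidelitySup n r : ℝ`, the isotypic
projectors Π_j, and a
certificate predicate once K_r(n) statements are filed.

Novelty: Searches. (A) 2026-08-15 opening planner (retained, abridged): `lit search --hybrid` "maximal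
overlap of a tensor with tensors of bounded border rank witness matrix multiplication" (10 local,
equations/secants only); zbMATH "border rank matrix multiplication approximation" (20:
Landsberg2005, LandsbergOttaviani2015, LandsbergMichalek2018, HauensteinIkenmeyerLandsberg2013,
ConnerHarperLandsberg2023, BiniEtAl1979; none metric); "sum of squares border rank tensor" (0
relevant); "Schmidt number witnesses multipartite tensor rank witness" (0); galaxy "border rank of
the matrix multiplication tensor" --star all (2); route review added Regula2017 and the sibling
routes ApproximationProfile / BrentRefutationDepth. (B) 2026-08-16 gen 1: `lit search` ×6 and galaxy
×1 → rc 75 (searchd down); `lit vsearch` ×4 (distance profile / ED degree / U⊗U⊗U twirling /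
robustness of border rank: Landsberg2017 pp 110, 126, 137; BengtssonZyczkowski2017 pp 450, 455;
EggelingWerner2001; DraismaEtAl2015 §8 = Segre only); `lit read arXiv:1911.07981` pp 3, 10, 16 (CHL
Thm 1.1, Prop 8.9). (C) 2026-08-16 gen 2 (this pass): `lit search` ×2 → rc 75 again (searchd down
01:5x–02:3xZ, logged); `lit vsearch` "best rank-r approximation … critical points … generalizing
Eckart–Young" (Golub–Van Loan, Landsberg2017 p 110; target paper not surfaced) then `lit read
arXiv:1711.06443` = DraismaOttavianiTocino2018 (HELD, pp 1–3 read: Thm 1.1 critical rank-≤k tensors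
of a GENERIC f lie in the critical space H_f; ⟨n,n,n⟩ is  [refs: 1911.07981, 1711.06443, 2206.08606, Landsberg2005, LandsbergOttaviani2015, LandsbergMichalek2018, HauensteinIkenmeyerLandsberg2013, ConnerHarperLandsberg2023, BiniEtAl1979, Regula2017, Landsberg2017, BengtssonZyczkowski2017, EggelingWerner2001, DraismaEtAl2015, DraismaOttavianiTocino2018, BlekhermanParriloThomas2012, Helton2002, BertaSutterWalter2023, TichavskyPhanCichocki2017, NavascuesPironioAci]

Barriers (technique_class: positivity-certificates, trace-SOS, isotypic-witness-cone): - technique_class: positivity-certificates, trace-SOS, isotypic-witness-cone, ED-critical-points,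
self-similarity
- Literature.Barriers.MatrixMultiplication.LinearRankMethodBarrier: its class is the subadditive
certificate rk M(T)/k of a LINEAR map M (flattenings, Koszul/Young flattenings, catalecticants; cap
6n² − 4 by cactus filling, Buczynski2026 Thm 2 / Cor 13; 8n² for rank methods,
EfremenkoGargOliveiraWigderson2018 Thm 4.4; narrowed entry 2026-08-15: WEAK border apolarity is
cactus-bounded too, BuczynskaBuczynski2026 Thm 1–2). Escaping hypothesis, per lever: (a) a witness
Q_a ≥ 0 is an INEQUALITY valid on σ_r and violated at ⟨n,n,n⟩; its trace-SOS / diagrammatic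
certificate quantifies over HONEST r-tuples of triads, so limits of non-smoothable schemes (cactus
points) are never in its domain and the filling argument says nothing about a metric gap — the
structural reason the catalogue lists nonlinear secant-specific methods (tangency flattenings,
DolezalekMichalek2026) as evasions; (b) DiagonalPowerDecay is outside the class by its DEFINING
INEQUALITY: in witness form a linear method L gives M(n,r) ≤ n³·(r·k)/rank L(T), i.e. at r = n² a
certified captured fraction ≥ n²k/rank L(T) > 1/6 (cactus cap) — a power-small fraction cannot come
from any L, however clever; (c) the unit-scale statements (SevenEighthsLaw, LinearDefectLaw) are
exact values of a distance, which no rank-of-a-linear-map bound expresses. Honest map of what IS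
inside the class: FlatteningWitness (Ky Fan on

Novelty grade: new-combination — ROUTE REVIEW+novelty (refuter 2026-08-15). new-combination = (i) witness/bipolar duality + complete SOS hierarchies from entanglement theory (DPS2004, Regula2017, Derksen2015/Nie2017 tensor-norm SOS) joined to (ii) border-rank lower bounds for <n,n,n> (Landsberg2005, HIL2013, LO2015, CHL2023); no me (refuter refuter-rreview-route-MatrixMultiplicati-88df8b29-0, 2026-08-15T13:43:38Z; prior: DohertyParriloSpedalieri2004,arXiv:1707.06298,Landsberg2005,arXiv:1305.0779,LandsbergOttaviani2015,ConnerHarperLandsberg2023,DesilvaLim2008,arXiv:1308.3860,route-MatrixMultiplication-ApproximationProfile,route-MatrixMultiplication-BrentRefutationDepth)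

History (route lifecycle, newest last):
- 2026-08-23T19:54:21Z · DORMANT — reconciler: no traction for 6.2 d (last activity item-evidence-added at 2026-08-17T14:27:53Z); parked, not closed — `ledger route dormant route-MatrixMultiplica (operator:999:3375938)

sub-problem: MatrixMultiplication · status: dormant · opened planner-plancard-MatrixMultiplication-MatrixM-168147eb-0 2026-08-15T11:38:24Z · rev 7 · ledger route-MatrixMultiplication-FidelityWitnesses
GENERATED by the gate from the ledger (D-0016/17). Provers cite these decls: `theorem foo : Summit.MatrixMultiplication.MatrixMultiplication.Theses.FidelityWitnesses.<Decl> := …` in Summits/MatrixMultiplication/MatrixMultiplication/Theorems/<Name>.lean.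
-/

namespace Summit.MatrixMultiplication.MatrixMultiplication.Theses.FidelityWitnesses

open scoped BigOperators Topology Manifold Classical MeasureTheory ProbabilityTheory Matrix InnerProductSpace ComplexConjugate ContinuousMap
open Filter Set Function TopologicalSpace MeasureTheory

attribute [summit_statement] _root_.MatrixMultiplication

/-- item stmt-MatrixMultiplication-4956 · crux (kind.auto-crux: conjecture-grade) · rank 0 · open · by planner
why it might fail: ⟺ ω > 2 (Bini + Alder–Strassen + completeness; `closes` certified): false iff the summit holds. Implied by crux DiagonalPowerDecay (block self-similarity); why this form is easier: thesis § WHY THIS FORM IS EASIER (4-parameter witness cone, (n,r)-formal certificates).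
sources: Blaser2013, BiniEtAl1979, LandsbergMichalek2018, Regula2017, arXiv:1710.09502, arXiv:2602.11309
[target] X as in § Thesis: δ, c > 0 with a fidelity gap ε(n, r) > 0 for every n ≥ 1 and every r ≤
c·n^{2+δ} (equivalently, via GapImpliesBorderRank, bR(⟨n,n,n⟩) > c·n^{2+δ}; superquadratic border
rank in witness form). -/
@[route_item "route-MatrixMultiplication-FidelityWitnesses", crux]
def FidelityThesis : Prop :=
  ∃ δ : ℝ, 0 < δ ∧ ∃ c : ℝ, 0 < c ∧ ∀ n r : ℕ, 1 ≤ n → (r : ℝ) ≤ c * (n : ℝ) ^ (2 + δ) → ∃ ε : ℝ, 0 < ε ∧ ∀ S : Fin n × Fin n → Fin n × Fin n → Fin n × Fin n → ℂ, Literature.Computability.AlgebraicComplexity.tensorRank S ≤ r → ‖∑ a, ∑ b, ∑ c, S a b c * Literature.Computability.AlgebraicComplexity.matMulTensor ℂ n n n a b c‖ ^ 2 ≤ (1 - ε) * (n : ℝ) ^ 3 * ∑ a, ∑ b, ∑ c, ‖S a b c‖ ^ 2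

/-- item stmt-MatrixMultiplication-18398 · crux · rank 2 · open · by planner
[crux] LOWER half of the SCC-dark host sandwich (crux-strategist BC2 redirect of the restated target
FidelityThesis ⟺ ω(ℂ) > 2): DARKNESS AT PRATT'S BALANCED TRIPARTITION TENSORS — the asymptotic rank
of T_k = tripartitionTensor ℂ k (dim C(3k,k) ≈ 6.75^k, Pratt2024SCC Def 1.4; T_1 ≅ cw_2) has rate 8:
for every ε ∈ (0,8), (8−ε)^k < R~(T_k) for all large k. Verbatim the CONCLUSION of the tree's named
fact pratt2024_cor_1_11 (SetCoverConjecture → this; Pratt2024SCC Cor 1.11), asked UNCONDITIONALLY: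
the first explicit counterexample family to Strassen's asymptotic rank conjecture (floor C(3k,k) ≤
R~(T_k) proved in tree, choose_le_asymptoticRank_tripartitionTensor; ceiling R(T_k) ≤ 8^k/2 via
ℂ[ℤ₂^{3k−1}], Pratt §1.2). It does not mention matrix multiplication and implies neither ω > 2 nor ω
= 2 (BC2 probes X₁ → S, X₁ → FidelityThesis fail); with the sibling MatMulHostsTripartition it gives
2 < ω(ℂ) (glue fidelityThesis_of_subs, proved). It REFUTES TkMinimal of route TripartitionBridge
and, with that route's DDown, BThesis (SccPrice). Where this route's technology enters: in witness
currency the statement is a family of fidelity gaps for the S_{3k} ≀ S_q-symmetric tensors T_k^{⊠q}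
at ran -/
@[route_item "route-MatrixMultiplication-FidelityWitnesses"]
def TripartitionDarkness : Prop :=
  ∀ ε : ℝ, 0 < ε → ε < 8 → ∃ k₀ : ℕ, ∀ k : ℕ, k₀ ≤ k → ((8 : ℝ) - ε) ^ k < Literature.Computability.AlgebraicComplexity.asymptoticRank (Literature.Computability.AlgebraicComplexity.tripartitionTensor ℂ k)

-- TODO item stmt-MatrixMultiplication-18413 · crux · rank 2 · open · by planner — BLOCKED: missing decl(s) x (ambiguous: 191 modules); restate via `ledger route edit` once they land:
--   def TripartitionDarkness2 : Prop := x

/-- item stmt-MatrixMultiplication-4957 · crux · rank 2 · closed · proved by Summit.MatrixMultiplication.MatrixMultiplication.Theorems.fidelityGapTwoSix_proof (prover) · by planner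
why it might fail: the degree-6 gap form is ≥ 0 but vanishes on {Σ t_l = 0} and degenerates along diverging border tuples (cancellation ratio → ∞), so it may be non-SOS at every affordable degree even with Reznick multipliers; then only a case split by cancellation ratio survives.
sources: Landsberg2005, HauensteinIkenmeyerLandsberg2013, DohertyParriloSpedalieri2004, GatermannParrilo2004, Reznick1992
[crux] worked instance (card W1, first rung): six (border) multiplications cannot be perfectly
correlated with 2×2 matrix multiplication — some ε > 0 has |⟨S,⟨2,2,2⟩⟩|² ≤ (1−ε)·8·‖S‖² for every S
of rank ≤ 6. Equivalent (WitnessCompleteness + Alder–Strassen) to Landsberg's bR(⟨2,2,2⟩) = 7, of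
which no formal proof exists; the intended proof is a K×S_6-reduced rational SOS / trace-SOS
certificate found by SDP (kit) and checked in Lean, i.e. the first kernel-checked proof of
bR(⟨2,2,2⟩) = 7 and the first border-rank bound proved by positivity. Numerics (folder num/): M(2,6)
≥ 6.9999997, so ε ≤ 1/8 + 4·10⁻⁸. [difficulty: L] -/
@[route_item "route-MatrixMultiplication-FidelityWitnesses"]
def FidelityGapTwoSix : Prop :=
  ∃ ε : ℝ, 0 < ε ∧ ∀ S : Fin 2 × Fin 2 → Fin 2 × Fin 2 → Fin 2 × Fin 2 → ℂ, Literature.Computability.AlgebraicComplexity.tensorRank S ≤ 6 → ‖∑ a, ∑ b, ∑ c, S a b c * Literature.Computability.AlgebraicComplexity.matMulTensor ℂ 2 2 2 a b c‖ ^ 2 ≤ (1 - ε) * 8 * ∑ a, ∑ b, ∑ c, ‖S a b c‖ ^ 2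

/-- item stmt-MatrixMultiplication-14053 · crux · rank 5 · open · by planner
why it might fail: Stronger than ω>2 (robustness at r = n²): false if ω = 2; no tool gives power gaps yet; φ(2..4) = 0.55, ≥0.37, ≥0.30 cannot refute ∃C,δ — a rank-n^{2+o(1)} family with captured fraction n^{−o(1)} (an L²-approximate scheme) kills it.
sources: LandsbergOttaviani2015, CoppersmithWinograd1982, Blaser2013, Pagh2013, Helton2002, ChurchEllenbergFarb2015
[crux] POWER-SCALE / UNIFORM LAYER (new, promote gen 2): DIAGONAL POWER DECAY — n² (border)
multiplications capture at most a power-small fraction of n×n matrix multiplication: some C and δ >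
0 have |⟨S,⟨n,n,n⟩⟩|² ≤ C·n^{3−2δ}·‖S‖² for every n and every S of rank ≤ n², i.e. φ(n) :=
M(n,n²)/n³ ≤ C·n^{−2δ}. (1) It IMPLIES ¬Statement on its own, by block self-similarity: p copies of
⟨m,m,m⟩ on the diagonal of ⟨pm,pm,pm⟩ form a sub-tensor of rank ≤ p·R(⟨m,m,m⟩) capturing p·m³ units,
so M(pm, p·R(⟨m⟩)) ≥ p·m³; with p = ⌈R(⟨m⟩)/m²⌉ the decay gives R(⟨m,m,m⟩) ≥ m^{2+δ/(1−δ)−o(1)},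
hence ω ≥ 2 + δ/(1−δ) (glue provable now from tree lemmas `matMulDirectSum`,
`omega_le_logb_tensorRank_matMulTensor`; and → FidelityThesis via Bini `Blaser2013_thm66_holds`). It
is STRONGER than ω > 2 exactly by a robustness statement (no rank-n^{2+o(1)} family reaches captured
fraction n^{−o(1)}). (2) Why this form: ONE point of the profile per n, strictly inside known
territory (bR(⟨n,n,n⟩) ≥ 2n² − n, LandsbergOttaviani2015, so T ∉ σ_{n²} is classical with margin n²
− n); a POWER gap is outside every linear rank method by the method's defining inequality (in
witness form a linear map certifies a captured fract -/
@[route_item "route-MatrixMultiplication-FidelityWitnesses"]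
def DiagonalPowerDecay : Prop :=
  ∃ C : ℝ, ∃ δ : ℝ, 0 < δ ∧ ∀ n : ℕ, ∀ S : Fin n × Fin n → Fin n × Fin n → Fin n × Fin n → ℂ, Literature.Computability.AlgebraicComplexity.tensorRank S ≤ n ^ 2 → ‖∑ a, ∑ b, ∑ c, S a b c * Literature.Computability.AlgebraicComplexity.matMulTensor ℂ n n n a b c‖ ^ 2 ≤ C * (n : ℝ) ^ (3 - 2 * δ) * ∑ a, ∑ b, ∑ c, ‖S a b c‖ ^ 2

/-- item stmt-MatrixMultiplication-14039 · support · rank 2 · open · by planner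
why it might fail: Extrapolated from n = 2 (tight only at r = 5, 6); at n = 3 it reads M(3,r) ≤ r + 27 − bR (≤ r + 10); one super-additive border scheme capturing > n³ + r − bR units, or M(2,6) > 7 (Hessian test j008849 / pencil root), refutes it.
sources: Mirsky1960, Derksen2015, DraismaOttavianiTocino2018, DesilvaLim2008, BiniEtAl1979, Winograd1971
[crux] LINEAR DEFECT LAW (new, 2026-08-16; the route's n-uniform structural conjecture): for every
n, r and every S of rank ≤ r, |⟨S,⟨n,n,n⟩⟩|² ≤ (n³ + r − bR(⟨n,n,n⟩))·‖S‖², i.e. M(n,r) ≤ n³ − (bR −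
r), i.e. dist(⟨n,n,n⟩, σ̂_r)² ≥ bR(⟨n,n,n⟩) − r: each missing border multiplication costs at least
one full unit product — Frobenius error buys border rank no cheaper than deleting products (bR here
= the tree's algBorderRank over ℂ = border rank by Alder–Strassen). Heuristic: ⟨n,n,n⟩ is
nuclear-flat (spectral norm 1, nuclear norm n³ = ‖T‖², Derksen2015), and for a matrix P with unit
singular values Eckart–Young–Mirsky gives rank B ≥ rank P − ‖P − B‖²_F; the law is the border-rank
analogue at T. Trivial for r ≥ bR (Cauchy–Schwarz) and for 0/1 deletions; implied by flattening only
for r ≤ (n³ − bR)/(n − 1) (r ≤ 5 at n = 3). n = 2 (bR = 7, tree): M(2,r) ≤ r + 1 — slack for r ≤ 4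
(1, 2, 3.006, 4.413 vs 2, 3, 4, 5), TIGHT at r = 5 (Bini, support SixEighthsAtFive) and r = 6 (=
SevenEighthsLaw, stmt-4959). Testable at n = 3 with bR ≥ 17 (CHL2023 Thm 1.1): M(3,r) ≤ r + 10 for r
≤ 16. k = 1 rung (UnitDefect): T ∉ σ̄_r ⇒ M(n,r) ≤ n³ − 1, whose necessary condition is bR(⟨n,n,n⟩ −
ρ·e) = bR(⟨n,n, -/
@[route_item "route-MatrixMultiplication-FidelityWitnesses", crux]
def LinearDefectLaw : Prop :=
  ∀ n r : ℕ, ∀ S : Fin n × Fin n → Fin n × Fin n → Fin n × Fin n → ℂ, Literature.Computability.AlgebraicComplexity.tensorRank S ≤ r → ‖∑ a, ∑ b, ∑ c, S a b c * Literature.Computability.AlgebraicComplexity.matMulTensor ℂ n n n a b c‖ ^ 2 ≤ ((n : ℝ) ^ 3 + (r : ℝ) - (Literature.Computability.AlgebraicComplexity.algBorderRank (Literature.Computability.AlgebraicComplexity.matMulTensor ℂ n n n) : ℝ)) * ∑ a, ∑ b, ∑ c, ‖S a b c‖ ^ 2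

/-- item stmt-MatrixMultiplication-4958 · support · rank 3 · open · by planner
why it might fail: ⟺ 18 ≤ bR(⟨3,3,3⟩), kernel-certified (Negative/BorderRankReduction.lean): an OPEN PROBLEM, window [17,20]; false iff a border-rank-17 scheme for 3×3 exists (Smirnov's 20 since 2013; degree-3 border apolarity leaves ≥ 499 candidates at r = 17).
sources: ConnerHarperLandsberg2023, arXiv:1911.07981, Smirnov2013, LandsbergMichalek2018, BuczynskaBuczynski2026, JelisiejewMandziuk2025
[crux] frontier instance (card W1, top rung): a fidelity gap at (n, r) = (3, 17) — |⟨S,⟨3,3,3⟩⟩|² ≤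
(1−ε)·27·‖S‖² for all S of rank ≤ 17 — i.e. (via GapImpliesBorderRank) bR(⟨3,3,3⟩) ≥ 18, one beyond
border apolarity's 17 (ConnerHarperLandsberg2023); known window bR(⟨3,3,3⟩) ∈ [17, 20]
(Smirnov2013). Either outcome is a theorem: a refutation is a border-rank-17 scheme for 3×3. [deps:
FidelityGapThreeSixteen] [difficulty: open-problem] -/
@[route_item "route-MatrixMultiplication-FidelityWitnesses"]
def FidelityGapThreeSeventeen : Prop :=
  ∃ ε : ℝ, 0 < ε ∧ ∀ S : Fin 3 × Fin 3 → Fin 3 × Fin 3 → Fin 3 × Fin 3 → ℂ, Literature.Computability.AlgebraicComplexity.tensorRank S ≤ 17 → ‖∑ a, ∑ b, ∑ c, S a b c * Literature.Computability.AlgebraicComplexity.matMulTensor ℂ 3 3 3 a b c‖ ^ 2 ≤ (1 - ε) * 27 * ∑ a, ∑ b, ∑ c, ‖S a b c‖ ^ 2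

/-- item stmt-MatrixMultiplication-4959 · support · rank 4 · open · by planner
why it might fail: Evidence is one-sided (160/160 exact-elimination ascents → 7 from below; Bini+1 family ↑ 7); the border stratum near ⟨2,2,2⟩ is invisible to honest optimisers — a pencil root u₀ ≠ 0 of [T+(u−1)E ∈ σ₆] with |log u₀| < 2√2, or an indefinite Hessian at ⟨2,2,2⟩ − e, refutes it.
sources: Landsberg2005, BiniEtAl1979, Winograd1971, DeGroote1978, BurgisserClausenShokrollahi1997, DesilvaLim2008
[crux] the sharp value at the first border instance: M(2,6) = 7, i.e. |⟨S,⟨2,2,2⟩⟩|² ≤ 7·‖S‖² for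
every S of rank ≤ 6 — no border-rank-6 tensor captures more than 7/8 of ⟨2,2,2⟩ (equality: ⟨2,2,2⟩
minus one term and its border/K-orbit relatives). New statement (implies FidelityGapTwoSix with ε =
1/8); suggested by the numerics (14/14 restarts of projective gradient ascent converge to 7.000000
from below, none above, while the same optimiser does find the super-additive optima 3.0058, 4.4134,
5.997 at r = 3, 4, 5); a sharp inequality with rigid equality cases is the natural SOS target.
[difficulty: L] -/
@[route_item "route-MatrixMultiplication-FidelityWitnesses", crux]
def SevenEighthsLaw : Prop :=
  ∀ S : Fin 2 × Fin 2 → Fin 2 × Fin 2 → Fin 2 × Fin 2 → ℂ, Literature.Computability.AlgebraicComplexity.tensorRank S ≤ 6 → ‖∑ a, ∑ b, ∑ c, S a b c * Literature.Computability.AlgebraicComplexity.matMulTensor ℂ 2 2 2 a b c‖ ^ 2 ≤ 7 * ∑ a, ∑ b, ∑ c, ‖S a b c‖ ^ 2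

/-- item stmt-MatrixMultiplication-14040 · support · rank 9 · open · by planner
sources: BiniEtAl1979, BurgisserClausenShokrollahi1997, Landsberg2005
[support] the (2,5) instance of LinearDefectLaw: M(2,5) ≤ 6 — five (border) multiplications capture
at most six of the eight unit products of ⟨2,2,2⟩; TIGHT on the BORDER (Bini's border-rank-5 scheme
= ⟨2,2,2⟩ minus the two c₂₂ products: overlap 6, ‖·‖² 6; BiniEtAl1979, BCS1997 §15.2), numerics
5.997 → 6 from below and never above (planner, 14 restarts); the extremiser is at infinity in triad
coordinates, so a certificate must carry denominators or live on the annihilator Grassmannian;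
refutable by one rank-5 S with value > 6 (`norm_num`), which would also kill LinearDefectLaw.
[difficulty: L] -/
@[route_item "route-MatrixMultiplication-FidelityWitnesses"]
def SixEighthsAtFive : Prop :=
  ∀ S : Fin 2 × Fin 2 → Fin 2 × Fin 2 → Fin 2 × Fin 2 → ℂ, Literature.Computability.AlgebraicComplexity.tensorRank S ≤ 5 → ‖∑ a, ∑ b, ∑ c, S a b c * Literature.Computability.AlgebraicComplexity.matMulTensor ℂ 2 2 2 a b c‖ ^ 2 ≤ 6 * ∑ a, ∑ b, ∑ c, ‖S a b c‖ ^ 2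

/-- item stmt-MatrixMultiplication-14041 · support · rank 9 · closed · proved by Summit.MatrixMultiplication.MatrixMultiplication.Theorems.fidelityGapTwoSixExplicit_proof @ 48f838a59a5b (prover) · by planner
sources: ConnerHarperLandsberg2023, BuczynskaBuczynski2026, GatermannParrilo2004, Landsberg2005
[support] the first EFFECTIVE margin at the first border instance: ε = 10⁻⁵, i.e. no tensor of rank
≤ 6 has fidelity above 1 − 10⁻⁵ with ⟨2,2,2⟩ (the proved FidelityGapTwoSix is ineffective;
SevenEighthsLaw would give 1/8). Home of the CHECKED skeleton
Cruxes/FidelityGapTwoSix/Lines/quantitative-apolarity.lean (robust weak border apolarity: a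
singular-value margin φ₀ of the (210)/(120) tests over the compact Stiefel manifold St(2, ℂ¹²) of
co-frames of Ann(⟨2,2,2⟩)(110) gives ε = min(1/640, φ₀²/640); landscape minimum ≈ 0.2697, 66 torus
frames at 1/√6 = MatMulTwo.rank_test_ge; φ₀ ≥ 0.08 suffices here; certify φ₀ by Putinar SOS on
St(2,12) or Nullstellensatz cofactors over ℚ). Not a crux: true as soon as M(2,6) ≤ 7.9999.
Calibrates the certificate technology; inside the cactus-bounded weak-BA class. [difficulty: L] -/
@[route_item "route-MatrixMultiplication-FidelityWitnesses"]
def FidelityGapTwoSixExplicit : Prop :=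
  ∀ S : Fin 2 × Fin 2 → Fin 2 × Fin 2 → Fin 2 × Fin 2 → ℂ, Literature.Computability.AlgebraicComplexity.tensorRank S ≤ 6 → ‖∑ a, ∑ b, ∑ c, S a b c * Literature.Computability.AlgebraicComplexity.matMulTensor ℂ 2 2 2 a b c‖ ^ 2 ≤ (1 - 1 / 100000) * 8 * ∑ a, ∑ b, ∑ c, ‖S a b c‖ ^ 2

/-- item stmt-MatrixMultiplication-14764 · support · rank 9 · closed · proved by Summit.MatrixMultiplication.MatrixMultiplication.Theorems.diagonalPowerDecayGlue_proof (prover) · by planner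
[support] GLUE (crux-only repair 2026-08-16, glue.unused-crux): the power-scale crux implies the
thesis — DiagonalPowerDecay → FidelityThesis — so the cone of `closes : FidelityThesis →
¬MatrixMultiplication` is X ⇐ DiagonalPowerDecay. PROVABLE NOW (three lines): by_contra;
`two_lt_omega_of_dpd : DiagonalPowerDecay → 2 < omega ℂ` (kernel-checked, sorry-free, in the crux
workfile Cruxes/DiagonalPowerDecay/Disproof.lean — via zero-padded ⟨m,m,m⟩ `padMM`, Kronecker
self-powers `kpow`, `rank_lower_of_body` R(⟨m,m,m⟩) ≥ m^{6/(3−2δ)}, `omega_ge_of_body` ω ≥ 6/(3−2δ);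
RE-LAND these under Theorems/DiagonalPowerDecay/… first, a Theses-importing Cruxes file is not
citable) against the LANDED `omega_le_two_of_not_fidelityThesis : ¬FidelityThesis → omega ℂ ≤ 2`
(Theorems/FidelityThesis/Negative/SummitEquivalence.lean, p83600: Bini `Blaser2013_thm66_holds` +
Alder–Strassen `alder_secantVariety_eq_setOf_algBorderRank_le_holds` + cone closure). Planner
due-diligence file: session folder GlueProofCheck.lean (the 3-line proof; farm had SummitEquivalence
unbuilt at filing time). [difficulty: S / provable-now] [sources: Blaser2013,
BurgisserClausenShokrollahi1997, CoppersmithWinograd1982] -/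
@[route_item "route-MatrixMultiplication-FidelityWitnesses"]
def DiagonalPowerDecayGlue : Prop :=
  DiagonalPowerDecay → FidelityThesis

/-- item stmt-MatrixMultiplication-4960 · support · rank 9 · closed · proved by Summit.MatrixMultiplication.MatrixMultiplication.Theorems.flatteningWitness_proof @ 8b73bc249cf9 (prover) · by planner
sources: LandsbergOttaviani2015, BurgisserClausenShokrollahi1997
[support] the part of the method INSIDE the linear-rank-method class, for calibration: the
flattening of ⟨n,n,n⟩ has n² singular values √n, so Ky Fan / |tr(A*B)| ≤ ‖B‖_op·√rank(A)·‖A‖_F gives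
M(n,r) ≤ n·r, i.e. |⟨S,⟨n,n,n⟩⟩|² ≤ n·r·‖S‖² for rank S ≤ r (fidelity form of bR ≥ n²; every crux
above must beat n·r). [difficulty: M] -/
@[route_item "route-MatrixMultiplication-FidelityWitnesses"]
def FlatteningWitness : Prop :=
  ∀ n r : ℕ, ∀ S : Fin n × Fin n → Fin n × Fin n → Fin n × Fin n → ℂ, Literature.Computability.AlgebraicComplexity.tensorRank S ≤ r → ‖∑ a, ∑ b, ∑ c, S a b c * Literature.Computability.AlgebraicComplexity.matMulTensor ℂ n n n a b c‖ ^ 2 ≤ (n : ℝ) * (r : ℝ) * ∑ a, ∑ b, ∑ c, ‖S a b c‖ ^ 2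

/-- item stmt-MatrixMultiplication-4961 · support · rank 9 · closed · proved by Summit.MatrixMultiplication.MatrixMultiplication.Theorems.gapImpliesBorderRank_proof (prover) · by planner
sources: BurgisserClausenShokrollahi1997, Blaser2013
[support] soundness of witnesses for the tree's ALGEBRAIC border rank (Bläser Def. 6.1 = BCS Def.
15.19): for T ≠ 0 over finite index types, a fidelity gap on rank-≤ r tensors forces r <
algBorderRank T (an order-h approximate decomposition Σ u(ε)v(ε)w(ε) = ε^h T + O(ε^{h+1}) gives
rank-≤ r tensors θ^{-h}Σ u(θ)v(θ)w(θ) → T as θ → 0, whose fidelity → 1). Turns every certificate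
into a border-rank theorem: with FidelityGapTwoSix, 7 ≤ bR(⟨2,2,2⟩). [difficulty: provable-now] -/
@[route_item "route-MatrixMultiplication-FidelityWitnesses"]
def GapImpliesBorderRank : Prop :=
  ∀ {ι κ μ : Type} [Fintype ι] [Fintype κ] [Fintype μ] (T : ι → κ → μ → ℂ) (r : ℕ), T ≠ 0 → (∃ ε : ℝ, 0 < ε ∧ ∀ S : ι → κ → μ → ℂ, Literature.Computability.AlgebraicComplexity.tensorRank S ≤ r → ‖∑ a, ∑ b, ∑ c, (starRingEnd ℂ) (S a b c) * T a b c‖ ^ 2 ≤ (1 - ε) * (∑ a, ∑ b, ∑ c, ‖S a b c‖ ^ 2) * (∑ a, ∑ b, ∑ c, ‖T a b c‖ ^ 2)) → r < Literature.Computability.AlgebraicComplexity.algBorderRank T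

/-- item stmt-MatrixMultiplication-4962 · support · rank 9 · closed · proved by Summit.MatrixMultiplication.MatrixMultiplication.Theorems.witnessCompleteness_proof (prover) · by planner
sources: Regula2017, DohertyParriloSpedalieri2004, DesilvaLim2008
[support] the bipolar / witness theorem in the classical topology (card support (i)): for T ≠ 0, T
is NOT a limit of rank-≤ r tensors iff a fidelity gap ε > 0 holds on all rank-≤ r tensors (⇐
continuity; ⇒ if S_k of rank ≤ r have fidelity → 1, rescale/rephase S_k to ‖S_k‖ = ‖T‖, ⟨S_k,T⟩ > 0,
then ‖S_k − T‖² = 2‖T‖²(1 − fidelity^{1/2}) → 0). With Alder–Strassen (cite fact requested) the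
closure is {algBorderRank ≤ r}, so witnesses are COMPLETE for border rank. [difficulty:
provable-now] -/
@[route_item "route-MatrixMultiplication-FidelityWitnesses"]
def WitnessCompleteness : Prop :=
  ∀ {ι κ μ : Type} [Fintype ι] [Fintype κ] [Fintype μ] (T : ι → κ → μ → ℂ) (r : ℕ), T ≠ 0 → (T ∉ closure {S : ι → κ → μ → ℂ | Literature.Computability.AlgebraicComplexity.tensorRank S ≤ r} ↔ ∃ ε : ℝ, 0 < ε ∧ ∀ S : ι → κ → μ → ℂ, Literature.Computability.AlgebraicComplexity.tensorRank S ≤ r → ‖∑ a, ∑ b, ∑ c, (starRingEnd ℂ) (S a b c) * T a b c‖ ^ 2 ≤ (1 - ε) * (∑ a, ∑ b, ∑ c, ‖S a b c‖ ^ 2) * (∑ a, ∑ b, ∑ c, ‖T a b c‖ ^ 2))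

/-- item stmt-MatrixMultiplication-4963 · support · rank 9 · closed · proved by Summit.MatrixMultiplication.MatrixMultiplication.Theorems.fidelityGapThreeSixteen_proof @ 64fb268e9d94 (prover) · by planner
sources: ConnerHarperLandsberg2023, ConnerHarperLandsberg2019
[support] calibration rung between the cruxes 2 and 3 (card W1): a fidelity gap at (3, 16), i.e. the
witness method re-derives border apolarity's bR(⟨3,3,3⟩) ≥ 17 (ConnerHarperLandsberg2019/2023) — a
known truth (modulo Alder–Strassen) with no formal proof; informative about the method's reach at n
= 3 before the open rung (3, 17) is attempted. [difficulty: XL] -/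
@[route_item "route-MatrixMultiplication-FidelityWitnesses"]
def FidelityGapThreeSixteen : Prop :=
  ∃ ε : ℝ, 0 < ε ∧ ∀ S : Fin 3 × Fin 3 → Fin 3 × Fin 3 → Fin 3 × Fin 3 → ℂ, Literature.Computability.AlgebraicComplexity.tensorRank S ≤ 16 → ‖∑ a, ∑ b, ∑ c, S a b c * Literature.Computability.AlgebraicComplexity.matMulTensor ℂ 3 3 3 a b c‖ ^ 2 ≤ (1 - ε) * 27 * ∑ a, ∑ b, ∑ c, ‖S a b c‖ ^ 2

/-- item stmt-MatrixMultiplication-4964 · support · rank 9 · closed · proved by Summit.MatrixMultiplication.MatrixMultiplication.Theorems.RankTwoAdditivity.rankTwoAdditivity_proof @ 7621d4dbdbca (prover) · by planner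
sources: Derksen2015, BurgisserClausenShokrollahi1997
[support] the surviving exact rung of the fidelity curve, uniform in n: M(n,2) = 2 — two (border)
multiplications capture at most 2 of the n³ units of ⟨n,n,n⟩: |⟨S,⟨n,n,n⟩⟩|² ≤ 2‖S‖² whenever rank S
≤ 2 (a trace inequality in six n×n matrices, |tr(u₁ᵀv₁w₁) + tr(u₂ᵀv₂w₂)|² ≤ 2‖u₁⊗v₁⊗w₁ + u₂⊗v₂⊗w₂‖²;
the smallest test of an n-UNIFORM trace-SOS template; numerically exact in 19/19 restarts at n = 2,
3, and sharp: it fails at rank 3, see RankThreeDefect). [difficulty: M] -/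
@[route_item "route-MatrixMultiplication-FidelityWitnesses"]
def RankTwoAdditivity : Prop :=
  ∀ n : ℕ, ∀ S : Fin n × Fin n → Fin n × Fin n → Fin n × Fin n → ℂ, Literature.Computability.AlgebraicComplexity.tensorRank S ≤ 2 → ‖∑ a, ∑ b, ∑ c, S a b c * Literature.Computability.AlgebraicComplexity.matMulTensor ℂ n n n a b c‖ ^ 2 ≤ 2 * ∑ a, ∑ b, ∑ c, ‖S a b c‖ ^ 2

/-- item stmt-MatrixMultiplication-4965 · support · rank 9 · closed · proved by Summit.MatrixMultiplication.MatrixMultiplication.Theorems.rankThreeDefect_proof (prover) · by planner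
sources: DesilvaLim2008, BiniEtAl1979
[support] super-additivity of fidelity starts at rank 3 over ℂ: some S of rank ≤ 3 in the 2×2 format
has |⟨S,⟨2,2,2⟩⟩|² > 3‖S‖² (numerical optimum 3.005813, an honest complex rank-3 tensor with
pairwise negative Gram entries; coordinates to 9 decimals in folder num/witness_2_3_seed2305.txt; an
open condition, so a nearby Gaussian-rational witness closes it by `norm_num`). Corrects the card's
conjecture r_add(n) ≥ n²; over ℝ the optimiser finds exactly 3. [difficulty: provable-now] -/
@[route_item "route-MatrixMultiplication-FidelityWitnesses"]
def RankThreeDefect : Prop :=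
  ∃ S : Fin 2 × Fin 2 → Fin 2 × Fin 2 → Fin 2 × Fin 2 → ℂ, Literature.Computability.AlgebraicComplexity.tensorRank S ≤ 3 ∧ 3 * ∑ a, ∑ b, ∑ c, ‖S a b c‖ ^ 2 < ‖∑ a, ∑ b, ∑ c, S a b c * Literature.Computability.AlgebraicComplexity.matMulTensor ℂ 2 2 2 a b c‖ ^ 2

/-- item stmt-MatrixMultiplication-4966 · assembly · rank 1 · closed · proved by Summit.MatrixMultiplication.MatrixMultiplication.Theorems.fidelityWitnesses_assembly_proof (prover) · by planner
sources: Blaser2013, BurgisserClausenShokrollahi1997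
[assembly] FidelityThesis → ¬MatrixMultiplication (S := ⟨n,n,n⟩ in the gap gives R(⟨n,n,n⟩) >
c·n^{2+δ}; then the proved BorderRankLowerBound assembly). -/
@[route_item "route-MatrixMultiplication-FidelityWitnesses"]
def Assembly : Prop :=
  FidelityThesis → ¬ MatrixMultiplication

/-! D-0027 §2.1 — DECIDING THEOREM (planner-authored via `route open/edit --closes-file`; by planner-rglue-MatrixMultiplication-FidelityWi-97da47f3-0 2026-08-16T00:51:16Z):
its hypotheses are this route's items and its conclusion the sub-problem Statement (glue_lint), and it elaborates with this file. -/

/-- Route glue (D-0027 §2.1, refutation line): the target `FidelityThesis` refutes the summit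
`ω(ℂ) = 2`. Fix `n ≥ 1` and put `r := R(⟨n,n,n⟩)`; if `r ≤ c·n^{2+δ}`, the fidelity gap at `(n, r)`
applied to `S := ⟨n,n,n⟩` itself (rank `r`; `∑ S·T = ∑ ‖T‖² = n³`, the number of ones of
`matMulTensor`) reads `n⁶ ≤ (1 − ε)·n³·n³`, absurd; hence `c·n^{2+δ} ≤ R(⟨n,n,n⟩)` for all `n ≥ 1`,
so every admissible exponent is `≥ 2 + δ` (`n^{2+δ−β} → ∞` for `β < 2 + δ`), `ω(ℂ) = sInf ≥ 2 + δ > 2`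
(`le_csInf` with `admissibleExponents_nonempty`) — the argument of the proved assembly of route
BorderRankLowerBound, inlined so that the route file needs no further import. -/
@[closes "route-MatrixMultiplication-FidelityWitnesses"] theorem closes : FidelityThesis → ¬ MatrixMultiplication := by
  rintro ⟨δ, hδ, c, hc, hgap⟩ hM
  -- (A) the self-overlap of `⟨n,n,n⟩`: its entries are `0/1` and exactly `n³` of them are `1`
  have hsum : ∀ (K : Type) [CommRing K] (n : ℕ),
      (∑ a : Fin n × Fin n, ∑ b : Fin n × Fin n, ∑ c : Fin n × Fin n,
        Literature.Computability.AlgebraicComplexity.matMulTensor K n n n a b c) = (n : K) ^ 3 := by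
    intro K _ n
    have h1 : ∀ a b : Fin n × Fin n,
        (∑ c : Fin n × Fin n, Literature.Computability.AlgebraicComplexity.matMulTensor K n n n a b c)
          = if a.1 = b.1 then 1 else 0 := by
      intro a b
      by_cases hab : a.1 = b.1
      · rw [if_pos hab, Finset.sum_eq_single (b.2, a.2)]
        · simp [Literature.Computability.AlgebraicComplexity.matMulTensor, hab]
        · intro c _ hc
          simp only [Literature.Computability.AlgebraicComplexity.matMulTensor]
          rw [if_neg]
          rintro ⟨-, h2, h3⟩
          exact hc (Prod.ext h2.symm h3.symm)
        · intro h
          exact absurd (Finset.mem_univ _) h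
      · rw [if_neg hab]
        exact Finset.sum_eq_zero fun c _ => by
          simp [Literature.Computability.AlgebraicComplexity.matMulTensor, hab]
    have h2 : ∀ a : Fin n × Fin n, (∑ b : Fin n × Fin n, if a.1 = b.1 then (1 : K) else 0) = n := by
      intro a
      rw [Fintype.sum_prod_type, Finset.sum_comm]
      simp
    simp_rw [h1, h2]
    simp [Finset.sum_const, Finset.card_univ, Fintype.card_prod, Fintype.card_fin]
    ring
  -- (B) the gap applied to `S := ⟨n,n,n⟩` forces `c·n^{2+δ} ≤ R(⟨n,n,n⟩)` for every `n ≥ 1`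
  have hrank : ∀ n : ℕ, 1 ≤ n → c * (n : ℝ) ^ (2 + δ) ≤
      (Literature.Computability.AlgebraicComplexity.tensorRank
        (Literature.Computability.AlgebraicComplexity.matMulTensor ℂ n n n) : ℝ) := by
    intro n hn
    by_contra hlt
    rw [not_le] at hlt
    obtain ⟨ε, hε, h⟩ := hgap n (Literature.Computability.AlgebraicComplexity.tensorRank
      (Literature.Computability.AlgebraicComplexity.matMulTensor ℂ n n n)) hn hlt.le
    have key := h (Literature.Computability.AlgebraicComplexity.matMulTensor ℂ n n n) le_rfl
    have hTT : ∀ a b c : Fin n × Fin n,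
        Literature.Computability.AlgebraicComplexity.matMulTensor ℂ n n n a b c *
          Literature.Computability.AlgebraicComplexity.matMulTensor ℂ n n n a b c
          = Literature.Computability.AlgebraicComplexity.matMulTensor ℂ n n n a b c := by
      intro a b c
      simp only [Literature.Computability.AlgebraicComplexity.matMulTensor]
      split_ifs <;> simp
    have hNN : ∀ a b c : Fin n × Fin n,
        ‖Literature.Computability.AlgebraicComplexity.matMulTensor ℂ n n n a b c‖ ^ 2
          = Literature.Computability.AlgebraicComplexity.matMulTensor ℝ n n n a b c := by
      intro a b c
      simp only [Literature.Computability.AlgebraicComplexity.matMulTensor]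
      split_ifs <;> simp
    simp_rw [hTT, hNN, hsum] at key
    have hn3 : ‖((n : ℂ)) ^ 3‖ ^ 2 = ((n : ℝ) ^ 3) * ((n : ℝ) ^ 3) := by
      rw [norm_pow, Complex.norm_natCast]
      ring
    rw [hn3] at key
    have hpos : (0 : ℝ) < (n : ℝ) ^ 3 * (n : ℝ) ^ 3 := by positivity
    nlinarith
  -- (C) a superquadratic rank lower bound makes every admissible exponent `≥ 2 + δ`, so `ω(ℂ) > 2`
  rw [MatrixMultiplication_iff] at hM
  have h2 : 2 + δ ≤ Literature.Computability.AlgebraicComplexity.omega ℂ := by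
    refine le_csInf (Literature.Computability.AlgebraicComplexity.admissibleExponents_nonempty ℂ) ?_
    intro β hβ
    by_contra hlt
    rw [not_le] at hlt
    obtain ⟨C, hC⟩ := hβ.bound
    have hev : ∀ᶠ n : ℕ in atTop, (n : ℝ) ^ (2 + δ - β) ≤ C / c := by
      filter_upwards [hC, eventually_ge_atTop 1] with n hn hn1
      have hpos : (0 : ℝ) < n := by exact_mod_cast hn1
      rw [Real.norm_of_nonneg (Nat.cast_nonneg _),
        Real.norm_of_nonneg (Real.rpow_nonneg hpos.le _)] at hn
      have hsq : c * (n : ℝ) ^ (2 + δ) ≤ C * (n : ℝ) ^ β := (hrank n hn1).trans hn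
      rw [Real.rpow_sub hpos, div_le_iff₀ (Real.rpow_pos_of_pos hpos _), div_mul_eq_mul_div,
        le_div_iff₀ hc]
      linarith
    have ht : Tendsto (fun n : ℕ => (n : ℝ) ^ (2 + δ - β)) atTop atTop :=
      (tendsto_rpow_atTop (by linarith)).comp tendsto_natCast_atTop_atTop
    obtain ⟨n, hn1, hn2⟩ := (hev.and (ht.eventually_gt_atTop (C / c))).exists
    exact absurd hn1 (not_le.mpr hn2)
  rw [hM] at h2
  linarith

end Summit.MatrixMultiplication.MatrixMultiplication.Theses.FidelityWitnesses
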